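import Summits.CriticalPhenomena.PercolationContinuityZ3.Theorems.PercNearOneGluingNoHeavyLowerTailSunflowerMultiPetalClutterPendant
import Summits.CriticalPhenomena.PercolationContinuityZ3.Theorems.PercNearOneGluingNoHeavyLowerTailSunflowerMultiPetalBottomSpectator
import HarnessLib
import HarnessLib.Audit

/-!
# `NoHeavyLowerTail` (crux stmt-CriticalPhenomena-4575), abstract sunflower cubic, `k` petals: LEMMA B FOR COLOURED CLUTTERS (typed conjecture
# `ClutterBottomSlackK`), the restriction monotonicity of the bottom-spectator functional (`ClutterRestrictionMonotonicityQK`), and the reductions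
# `ClutterRestrictionMonotonicityQK ⟹ ClutterBottomSlackK ⟹ ★ₖ` for the clutter structure of every set family

Support file (seat `prim-l12-p2` gen 36; `--supports stmt-CriticalPhenomena-4575`; companion of `…SunflowerMultiPetalBottomSpectator` (p379785: `qK`, `MSunflower.QKW`,
`QKW_le_ZKW`, `QKW_univ_eq_spec`) and `…SunflowerMultiPetalClutterPendant` (p377908: `MSunflower.ofClutter`)).  No `sorry`; nothing is asserted about the crux;
the two `@[conjecture]` definitions are obligations of the programme, never facts.
Memo: run/shared/lean/prim/prim-l12/prim-l12-p2/FINDING-g36-BOTTOM-SPECTATOR.md §1–2.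

CONTEXT.  For a set family `E : Fin k → Finset α` the clutter structure `ofClutter E` labels `X` bottom / petal `i` / top as `X` contains no edge / exactly the
edges of colour `i` / two edges of different colours.  Its bottom-spectator functional `QKW univ = 3·SwK [bottom] − NtriK` (p379785) satisfies `QKW ≤ ZKW`; in the
language of this seat's earlier memos `0 ≤ QKW univ` is "LEMMA B": the rainbows are paid by the white (bottom) spectators' Gladkov slack alone.  Lemma B is FALSE
for general monotone maps into `M_k` (doubled star, gen 5: a non-injective colouring, not of the form `ofClutter E`), but for coloured clutters no failure is known:

EVIDENCE (memo §1–2; exact integer enumeration).  `0 ≤ QKW univ` for the edge family of EVERY simple graph on ≤ 9 vertices (all 288 266 isomorphism types;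
equality only for 2K₂, 3K₂ plus isolated points; smallest other ratio `2A₁/(B₁+B₃) = 1.004` at 4K₂, then ≥ 1.40), for all antichains of subsets of ≤ 5 points,
1.5·10⁶ sampled antichains on 6 points and 3.2·10⁵ sampled general families (repeated / nested / singleton edges) on ≤ 6 points.  The stronger
`ClutterRestrictionMonotonicityQK` (one-point monotonicity of `QKW` at EVERY point) holds at every vertex of every graph on ≤ 9 vertices (2 458 413 + 97 515 + …
instances) and in all the sampled families; it is a THEOREM at petal-completing points and at non-bottom singletons (termwise; companion file
`…SunflowerMultiPetalBottomSpectatorOrder`), FALSE termwise at every other vertex type (LP certificates, memo §4.6), and its kernel has an explicit five-term form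
(memo §2) of which two pieces are proved by injections (memo §4.1–4.2).

* `ClutterBottomSlackK` (OPEN): `0 ≤ (ofClutter E).QKW univ` for every family.  * `ClutterRestrictionMonotonicityQK` (OPEN): `QKW W ≤ QKW (insert e W)`.
* `clutterBottomSlackK_of_restrictionMonotonicityQK`, `ZK_ofClutter_nonneg_of_clutterBottomSlackK` (★ₖ for every coloured clutter — all graphs, all hypergraphs),
  `NtriK_ofClutter_le_of_clutterBottomSlackK` (the Lemma-B inequality `NtriK ≤ 3·SwK [bottom]`).
-/

namespace Summit.CriticalPhenomena.PercolationContinuityZ3.Theorems.SunflowerPartition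

open Finset

/-- **LEMMA B FOR COLOURED CLUTTERS** (this work; OPEN; evidence in the file header): the bottom-spectator functional of the clutter structure of every set family
is nonnegative, `0 ≤ QKW univ` (`= 3·SwK [bottom] − NtriK`).  Implies ★ₖ for every coloured clutter (`ZK_ofClutter_nonneg_of_clutterBottomSlackK`).
An obligation, never a fact: use as `(h : ClutterBottomSlackK)`. [status: open] -/
@[conjecture] def ClutterBottomSlackK : Prop :=
  ∀ (k : ℕ) (α : Type) [Fintype α] [DecidableEq α] (E : Fin k → Finset α), 0 ≤ (MSunflower.ofClutter E).QKW univ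

/-- **RESTRICTION MONOTONICITY OF THE BOTTOM-SPECTATOR FUNCTIONAL FOR COLOURED CLUTTERS** (this work; OPEN; evidence in the file header): for every family,
every sub-cube `W` and every point `e ∉ W`, `QKW W ≤ QKW (insert e W)`.  Implies `ClutterBottomSlackK`.  An obligation, never a fact. [status: open] -/
@[conjecture] def ClutterRestrictionMonotonicityQK : Prop :=
  ∀ (k : ℕ) (α : Type) [Fintype α] [DecidableEq α] (E : Fin k → Finset α) (W : Finset α) (e : α), e ∉ W →
    (MSunflower.ofClutter E).QKW W ≤ (MSunflower.ofClutter E).QKW (insert e W)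

/-- **Restriction monotonicity of `Q` ⟹ Lemma B** (induction on the sub-cube from `QKW ∅ = 0`). [this work] -/
theorem clutterBottomSlackK_of_restrictionMonotonicityQK (h : ClutterRestrictionMonotonicityQK) : ClutterBottomSlackK := by
  intro k α _ _ E
  have key : ∀ W : Finset α, 0 ≤ (MSunflower.ofClutter E).QKW W := by
    intro W
    induction W using Finset.induction with
    | empty => rw [(MSunflower.ofClutter E).QKW_empty]
    | insert e W he ih => exact le_trans ih (h k α E W e he)
  exact key univ

/-- **Lemma B ⟹ ★ₖ for every coloured clutter** (all graphs, all hypergraphs, every number of colours): `0 ≤ ZK (ofClutter E)`. [this work] -/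
theorem ZK_ofClutter_nonneg_of_clutterBottomSlackK (h : ClutterBottomSlackK) {k : ℕ} {α : Type} [Fintype α] [DecidableEq α]
    (E : Fin k → Finset α) : 0 ≤ (MSunflower.ofClutter E).ZK := by
  rw [← (MSunflower.ofClutter E).ZKW_univ]
  exact le_trans (h k α E) ((MSunflower.ofClutter E).QKW_le_ZKW univ)

/-- **Lemma B as an inequality**: under `ClutterBottomSlackK`, `NtriK ≤ 3·SwK [bottom]` for every coloured clutter. [this work] -/
theorem NtriK_ofClutter_le_of_clutterBottomSlackK (h : ClutterBottomSlackK) {k : ℕ} {α : Type} [Fintype α] [DecidableEq α]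
    (E : Fin k → Finset α) : (MSunflower.ofClutter E).NtriK ≤ 3 * (MSunflower.ofClutter E).SwK (botK k) := by
  have h1 := h k α E
  rw [(MSunflower.ofClutter E).QKW_univ_eq_spec] at h1
  linarith

end Summit.CriticalPhenomena.PercolationContinuityZ3.Theorems.SunflowerPartition
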